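import Literature.AlgebraicGeometry.Modules.ModuleCechComplex
import Literature.Algebra.Homology.OrderedCechSystemLTensor
import Literature.AlgebraicGeometry.Motives.CoherentFracFamily
import HarnessLib

/-!
# Pruning, functoriality in the module, and cover data of the module Čech complex (utilities for GW II 23.133)

Three utilities on the module Čech complex `Č•(𝓦, L)` of `Modules/ModuleCechComplex` (an `𝒪_Y`-module `L`,
a finite linearly ordered family of opens `𝓦 = (W_i)_i` of a scheme `Y`, a base ring `ρ : A → Γ(Y, 𝒪_Y)`):

* **pruning** (`Modules.NonemptyIdx`, `Modules.pruned`, **`Modules.prunedCechIso`**): discarding the members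
  with EMPTY open does not change the complex — the omitted terms `Γ(L, W_s)`, `W_s = ∅`, are zero
  (`subsingleton_secMod_of_eq_bot`), so the restriction to the subfamily of non-empty members
  (`Algebra/Homology/OrderedCechSystemLTensor`: `OrderedCech.sysRestrictIso`) is an isomorphism;
* **functoriality in the module** (`Modules.SecMod.map`, **`Modules.sectionsSystemIsoOfIso`**): an isomorphism
  `L ≅ L'` of `𝒪_Y`-modules induces `Č•(𝓦, L) ≅ Č•(𝓦, L')` (`OrderedCech.sysComplexIsoNE`);
* **cover data** (`Modules.cechCoverData`): on an INTEGRAL `Y`, a cover by non-empty opens with affine finite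
  intersections is a `FracFamily.CoverData` of the tree (`Motives/CoherentFracFamily`), `U_t = W_t`, `U_∅ = Y`
  — the input format of the coherent rank-one dévissage `Motives/CechCoherentDevissage`.

These are the reductions used in Görtz–Wedhorn II, proof of Thm. 23.133 (Step (I): pass to a finite affine
cover, compare Čech complexes along isomorphisms) and Def. 21.68 (the ordered complex of a subfamily).
Everything is proved; no named facts. Mathlib searched (pin): `TopCat.Sheaf.isTerminalOfEqEmpty`,
`OrderEmbedding.subtype`, `Finset.map` (used). Cell `hodgecm-mathlib`, M13 node N1 (1a-γ) (B-p10 (g8),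
cut/couriered by B-p15 (g8) per B-plan1 R140/R142); generic, books 0.

## References

* U. Görtz, T. Wedhorn, *Algebraic Geometry II: Cohomology of Schemes* (2023),
  doi:10.1007/978-3-658-43031-3: Def. 21.68 (p. 180); Thm. 23.133, proof, Step (I) (p. 354). [GortzWedhorn2023]
* D. Mumford, *Abelian Varieties*, TIFR Studies in Mathematics 5 (1970), §5. [MumfordAV1970]
-/

universe u

open CategoryTheory CategoryTheory.Limits AlgebraicGeometry TopologicalSpace Opposite MonoidalCategory
open CartesianMonoidalCategory TensorProduct
open Literature.AlgebraicGeometry.Motives Literature.Algebra.Homology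

set_option backward.isDefEq.respectTransparency false

noncomputable section

namespace Literature.AlgebraicGeometry.Modules

/-! ### Pruning the members with empty open -/

section Prune

variable {Y : Scheme.{u}} {ι : Type} [LinearOrder ι] (𝓦 : ι → Y.Opens) (L : Y.Modules)
  {A : Type u} [CommRing A] (ρ : A →+* Γ(Y, ⊤))

/-- Sections of an `𝒪_Y`-module over an empty open are unique. [folklore] [cite: GortzWedhorn2023, Def. 21.68 (p. 180)] -/
theorem subsingleton_secMod_of_eq_bot {U : Y.Opens} (hU : U = ⊥) : Subsingleton (SecMod L ρ U) :=
  AddCommGrpCat.subsingleton_of_isZero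
    ((TopCat.Sheaf.isTerminalOfEqEmpty (⟨L.presheaf, Scheme.Modules.isSheaf L⟩ : TopCat.Sheaf Ab Y) hU).isZero)

/-- The indices whose open is non-empty. [folklore] [cite: GortzWedhorn2023, Def. 21.68 (p. 180)] -/
def NonemptyIdx : Type := {i : ι // ((𝓦 i : Set Y)).Nonempty}

/-- `NonemptyIdx` inherits the linear order. [folklore] [cite: GortzWedhorn2023, Def. 21.68 (p. 180)] -/
instance : LinearOrder (NonemptyIdx 𝓦) := inferInstanceAs (LinearOrder {i : ι // ((𝓦 i : Set Y)).Nonempty})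

/-- `NonemptyIdx` is finite. [folklore] [cite: GortzWedhorn2023, Def. 21.68 (p. 180)] -/
instance [Fintype ι] : Fintype (NonemptyIdx 𝓦) := by
  classical
  exact inferInstanceAs (Fintype {i : ι // ((𝓦 i : Set Y)).Nonempty})

/-- The order embedding `NonemptyIdx 𝓦 ↪o ι`. [folklore] [cite: GortzWedhorn2023, Def. 21.68 (p. 180)] -/
def nonemptyEmb : NonemptyIdx 𝓦 ↪o ι := OrderEmbedding.subtype _

/-- The pruned cover. [folklore] [cite: GortzWedhorn2023, Def. 21.68 (p. 180)] -/
def pruned : NonemptyIdx 𝓦 → Y.Opens := fun i => 𝓦 i.1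

omit [LinearOrder ι] in
/-- Membership in `V_s`: `y ∈ V_s ↔ ∀ i ∈ s, y ∈ V_i`. [folklore] [cite: GortzWedhorn2023, Def. 21.68 (p. 180)] -/
theorem mem_cechOpen_iff {s : Finset ι} {y : Y} : y ∈ cechOpen 𝓦 s ↔ ∀ i ∈ s, y ∈ 𝓦 i := by
  classical
  unfold cechOpen
  induction s using Finset.induction_on with
  | empty => simp
  | insert a s ha ih =>
    rw [Finset.inf_insert, Opens.mem_inf, ih]
    simp

/-- `V_{e(s)} = V^{pruned}_s`. [folklore] [cite: GortzWedhorn2023, Def. 21.68 (p. 180)] -/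
theorem cechOpen_map_nonemptyEmb (s : Finset (NonemptyIdx 𝓦)) :
    cechOpen 𝓦 (s.map (nonemptyEmb 𝓦).toEmbedding) = cechOpen (pruned 𝓦) s := by
  unfold cechOpen pruned
  rw [Finset.inf_map]
  rfl

/-- A non-empty `s` not coming from the non-empty indices has `V_s = ∅`. [folklore] [cite: GortzWedhorn2023, Def. 21.68 (p. 180)] -/
theorem cechOpen_eq_bot_of_not_range {s : Finset ι} (_hs : s.Nonempty)
    (h : ¬ ∃ s' : Finset (NonemptyIdx 𝓦), s'.map (nonemptyEmb 𝓦).toEmbedding = s) :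
    cechOpen 𝓦 s = ⊥ := by
  classical
  -- some member of `s` has empty open
  by_contra hne
  apply h
  have hall : ∀ i ∈ s, ((𝓦 i : Set Y)).Nonempty := by
    intro i hi
    obtain ⟨y, hy⟩ : ((cechOpen 𝓦 s : Set Y)).Nonempty := by
      rw [Set.nonempty_iff_ne_empty]
      intro he
      exact hne (Opens.ext he)
    exact ⟨y, (mem_cechOpen_iff 𝓦).1 hy i hi⟩
  refine ⟨s.attach.map ⟨fun i => (⟨i.1, hall i.1 i.2⟩ : NonemptyIdx 𝓦), fun i j hij => by
    apply Subtype.ext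
    have := congrArg (fun k : NonemptyIdx 𝓦 => (k.1 : ι)) hij
    simpa using this⟩, ?_⟩
  ext i
  simp only [Finset.mem_map, Finset.mem_attach, true_and, Subtype.exists, Function.Embedding.coeFn_mk]
  constructor
  · rintro ⟨_, ⟨j, hj, rfl⟩, rfl⟩
    exact hj
  · intro hi
    exact ⟨⟨i, hall i hi⟩, ⟨i, hi, rfl⟩, rfl⟩

/-- Restriction along an EQUALITY of opens, as an `A`-linear isomorphism. [folklore] [cite: GortzWedhorn2023, Def. 21.68 (p. 180)] -/
def SecMod.resEquiv {U W : Y.Opens} (h : U = W) : SecMod L ρ U ≃ₗ[A] SecMod L ρ W :=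
  LinearEquiv.ofLinear (SecMod.res L ρ h.symm.le) (SecMod.res L ρ h.le)
    (by apply LinearMap.ext; intro x; rw [LinearMap.comp_apply, SecMod.res_res, SecMod.res_self]; rfl)
    (by apply LinearMap.ext; intro x; rw [LinearMap.comp_apply, SecMod.res_res, SecMod.res_self]; rfl)

/-- `resEquiv` is a restriction. [folklore] [cite: GortzWedhorn2023, Def. 21.68 (p. 180)] -/
@[simp] theorem SecMod.resEquiv_apply {U W : Y.Opens} (h : U = W) (x : SecMod L ρ U) :
    SecMod.resEquiv L ρ h x = SecMod.res L ρ h.symm.le x := rfl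

/-- **Pruning**: `Č•(𝓦, L) ≅ Č•(𝓦 ∘ e, L)` for the embedding `e` of the non-empty indices (the dropped
simplices carry `Γ(∅, L) = 0`; F1 `sysRestrictIso`), followed by the re-indexing `V_{e(s)} = V^{pruned}_s`.
[folklore] [cite: GortzWedhorn2023, Def. 21.68 (p. 180)] -/
def prunedCechIso : cechComplex 𝓦 L ρ ≅ cechComplex (pruned 𝓦) L ρ :=
  OrderedCech.sysRestrictIso (nonemptyEmb 𝓦) (sectionsSystem 𝓦 L ρ) (fun s hs h =>
      subsingleton_secMod_of_eq_bot L ρ (cechOpen_eq_bot_of_not_range 𝓦 hs h)) ≪≫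
    OrderedCech.sysComplexIsoNE
      (fun s _ => SecMod.resEquiv L ρ (cechOpen_map_nonemptyEmb 𝓦 s))
      (fun s t hs ht h x => by
        change SecMod.res L ρ _ (SecMod.res L ρ _ x) = SecMod.res L ρ _ (SecMod.res L ρ _ x)
        erw [SecMod.res_res, SecMod.res_res])

end Prune

/-! ### Functoriality of the module Čech complex in isomorphisms of modules -/

section IsoMod

variable {Y : Scheme.{u}} {ι : Type} [LinearOrder ι] (𝓦 : ι → Y.Opens) {L L' : Y.Modules} (φ : L ≅ L')
  {A : Type u} [CommRing A] (ρ : A →+* Γ(Y, ⊤))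

/-- The `A`-linear map on sections induced by a morphism of modules. [folklore] [cite: GortzWedhorn2023, Def. 21.68 (p. 180)] -/
def SecMod.map (ψ : L ⟶ L') (U : Y.Opens) : SecMod L ρ U →ₗ[A] SecMod L' ρ U where
  toFun x := SecMod.mk (ψ.app U (SecMod.val x))
  map_add' x y := by
    change SecMod.mk (ψ.app U (SecMod.val x + SecMod.val y)) = _
    rw [map_add]; rfl
  map_smul' a x := by
    apply SecMod.val_injective
    change ψ.app U (toSections ρ U a • SecMod.val x) = toSections ρ U a • ψ.app U (SecMod.val x)
    exact Scheme.Modules.Hom.app_smul ψ _ _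

/-- `SecMod.map` on underlying sections. [folklore] [cite: GortzWedhorn2023, Def. 21.68 (p. 180)] -/
@[simp] theorem SecMod.val_map (ψ : L ⟶ L') (U : Y.Opens) (x : SecMod L ρ U) :
    SecMod.val (SecMod.map ρ ψ U x) = ψ.app U (SecMod.val x) := rfl

/-- **`Č•(𝓦, L) ≅ Č•(𝓦, L')` for an isomorphism `L ≅ L'`.** [folklore] [cite: GortzWedhorn2023, Def. 21.68 (p. 180)] -/
def sectionsSystemIsoOfIso : cechComplex 𝓦 L ρ ≅ cechComplex 𝓦 L' ρ :=
  OrderedCech.sysComplexIsoNE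
    (fun s _ => LinearEquiv.ofLinear (SecMod.map ρ φ.hom (cechOpen 𝓦 s)) (SecMod.map ρ φ.inv (cechOpen 𝓦 s))
      (by
        apply LinearMap.ext; intro x; apply SecMod.val_injective (ρ := ρ)
        change (φ.inv ≫ φ.hom).app _ (SecMod.val (ρ := ρ) x) = SecMod.val (ρ := ρ) x
        rw [φ.inv_hom_id]; rfl)
      (by
        apply LinearMap.ext; intro x; apply SecMod.val_injective (ρ := ρ)
        change (φ.hom ≫ φ.inv).app _ (SecMod.val (ρ := ρ) x) = SecMod.val (ρ := ρ) x
        rw [φ.hom_inv_id]; rfl))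
    (fun s t hs ht h x => by
      apply SecMod.val_injective (ρ := ρ)
      change φ.hom.app _ (L.presheaf.map _ (SecMod.val (ρ := ρ) x)) = L'.presheaf.map _ (φ.hom.app _ (SecMod.val (ρ := ρ) x))
      exact ConcreteCategory.congr_hom (φ.hom.mapPresheaf.naturality (homOfLE (cechOpen_anti 𝓦 h)).op) _)

end IsoMod

/-! ### The cover data of a cover by non-empty affine opens of an integral scheme -/

section Cover

variable {Y : Scheme.{u}} [IsIntegral Y] {ι : Type} (𝓦 : ι → Y.Opens)
  (hne : ∀ i, ((𝓦 i : Set Y)).Nonempty) (haff : ∀ s : Finset ι, s.Nonempty → IsAffineOpen (cechOpen 𝓦 s))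
  (hcov : ⨆ i, 𝓦 i = ⊤)

include hne in
/-- The generic point lies in every `V_s` (the `V_i` being non-empty). [folklore] [cite: GortzWedhorn2023, Def. 21.68 (p. 180)] -/
theorem genericPoint_mem_cechOpen (s : Finset ι) : genericPoint Y ∈ cechOpen 𝓦 s :=
  (mem_cechOpen_iff 𝓦).2 fun i _ => by
    obtain ⟨y, hy⟩ := hne i
    exact RatFn.genericPoint_mem_of_mem hy

/-- **The tree's `FracFamily.CoverData` of the cover** (`U_t = V_t`, `U_∅ = Y`). [folklore] [cite: GortzWedhorn2023, Def. 21.68 (p. 180)] -/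
def cechCoverData : FracFamily.CoverData Y ι where
  U := cechOpen 𝓦
  anti := fun _ _ h => cechOpen_anti 𝓦 h
  mem_of_forall := fun t _ y hy => (mem_cechOpen_iff 𝓦).2 fun i hi => by
    have := hy i hi
    rwa [cechOpen_singleton] at this
  affine := fun t ht => haff t ht
  genericPoint_mem := genericPoint_mem_cechOpen 𝓦 hne
  exists_mem := fun y => by
    have hy : y ∈ (⊤ : Y.Opens) := trivial
    rw [← hcov, Opens.mem_iSup] at hy
    obtain ⟨i, hi⟩ := hy
    exact ⟨i, by rwa [cechOpen_singleton]⟩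

/-- `U_∅ = Y`. [folklore] [cite: GortzWedhorn2023, Def. 21.68 (p. 180)] -/
theorem cechCoverData_U_empty : (cechCoverData 𝓦 hne haff hcov).U ∅ = ⊤ := cechOpen_empty 𝓦

end Cover

end Literature.AlgebraicGeometry.Modules

end
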